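import Literature.Barriers.FinalStateConjecture.ExtremalHorizonNEnergyEstimate
import Literature.Barriers.FinalStateConjecture.ExtremalHorizonHardy
import HarnessLib

/-!
# The near-horizon `N`-energy bound on extremal Kerr with the zeroth-order terms absorbed
# (Aretakis 2012, §13.1 on `𝓐_N`, modulo the outer flux)

(family `gr`; proving seat of `Literature.Barriers.FinalStateConjecture.Aretakis2012_pointwiseDecay`
— Aretakis, JFA 263 (2012), Thm. 5 — reduced by `ExtremalHorizonPointwiseDecayFromEnergy.lean` to the
uniform boundedness of the non-degenerate energy near `𝓗⁺` (Thm. 2) and integrated decay (Thm. 1).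
§13.1 of the source proves Thm. 2 by Stokes for `J^{N,δ,−1/2}`: the bulk is non-negative on `𝓐_N`
(Prop. 7.2.1), the horizon flux is non-negative, and the zeroth-order terms of the energy are
absorbed by Cauchy–Schwarz and the Hardy inequalities (4.1)–(4.2) into the `T`-energy, which is
conserved (Prop. 5.1.2). This file carries out exactly these steps for the class of the fact, on
the near-horizon region `𝓐_N = {M ≤ r ≤ 23M/21}`; the one term left explicit is the flux of
`J^{N,−1/2}` through the outer cylinder `{r = 23M/21}`, which the source controls by the cut-off
extension `N^δ` of `N` together with the integrated decay estimate of Thm. 1 (§§9–12).)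

* `Kerr.line_sq_le_hardy` — the first Hardy inequality along an `r`-line of a box in Kerr-star
  coordinates: `∫_M^R G² ≤ 4 ∫_M^R (r − M)² (∂_r G)²` when `G(R) = 0`;
* `Kerr.nEnergy_absorbed_box_estimate` (**coordinates**): for `G` smooth on an open
  `W₀ ⊇ [t₁, t₂] × [M, R] × [0, π]`, `R ≥ 23M/21`, with `𝓡G + 𝓐G = 0` off the axis and `G`, `∂G`
  vanishing on the outer cylinder `{r = R}`:
  `½ ∫∫ e_low(t₂) + ∫_{t₁}^{t₂}∫∫ K_low ≤ ∫∫ E_N(t₁) + ∫_{t₁}^{t₂}∫₀^π F_N(t, 23M/21, θ) + 216 M · E_T(t₁; [M, R])`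
  (`E_T(t; [M, R]) = ∫₀^π∫_M^R tEnergy`, the degenerate `T`-energy of `KerrStarEnergyIdentity.lean`);
* `Kerr.nEnergy_bound_of_class` (**the class**): the same for `G = Φ ∘ κ`, `Φ` smooth at the points
  of an open `U₀ ⊇ {r ≥ M, t* ≥ 0}` of the extremal Kerr region, axisymmetric, solving `□_g ψ = 0`
  on `U₀`, with Cauchy data vanishing for `|x| > ρ` on `{t* = 0}`; `R = r₂ > max(ρ, 2M) + 1 + T`,
  `0 ≤ t₁ ≤ t₂ ≤ T` (finite speed of propagation, `ExtremalHorizonFiniteSpeed.lean`).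

Everything is proved; no named facts.

## References

* S. Aretakis, *Decay of axisymmetric solutions of the wave equation on extreme Kerr backgrounds*,
  J. Funct. Anal. 263 (2012) 2770–2831 (arXiv:1110.2006): §13.1 (proof of Thm. 2), Prop. 13.2.1,
  §4.4 (Hardy inequalities), Prop. 5.1.2, Prop. 7.2.1 (key `Aretakis2012`).
-/

noncomputable section

open Real Set Filter MeasureTheory intervalIntegral
open scoped Topology ContDiff Manifold

namespace Literature.Barriers.FinalStateConjecture.Kerr

open Literature.Geometry.Lorentzian
open Literature.Geometry.Lorentzian.Kerr.StarCoord

/-! ### Coordinate level -/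

section Coord

variable {M : ℝ} {W₀ : Set E4} {G : E4 → ℝ}

/-- **The first Hardy inequality along an `r`-line** of a box in Kerr-star coordinates:
`∫_M^R G(p(t,r,θ))² dr ≤ 4 ∫_M^R (r − M)² (∂_r G)(p(t,r,θ))² dr` when `G(p(t,R,θ)) = 0`.
[cite: Aretakis2012, §4.4 (Prop. 4.4.1)] -/
theorem line_sq_le_hardy (hW₀ : IsOpen W₀) (hG : ContDiffOn ℝ ∞ G W₀) {t R φ₀ θ : ℝ} (hR : M ≤ R)
    (hline : ∀ r ∈ Icc M R, boxPoint φ₀ t r θ ∈ W₀) (hGR : G (boxPoint φ₀ t R θ) = 0) :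
    ∫ r in M..R, G (boxPoint φ₀ t r θ) ^ 2 ≤
      4 * ∫ r in M..R, (r - M) ^ 2 * pd 1 G (boxPoint φ₀ t r θ) ^ 2 := by
  have hd : ∀ r ∈ Icc M R, DifferentiableAt ℝ G (boxPoint φ₀ t r θ) := fun r hr ↦
    (hG.differentiableOn (by simp)).differentiableAt (hW₀.mem_nhds (hline r hr))
  have hderiv : ∀ r ∈ Icc M R, HasDerivAt (fun r' ↦ G (boxPoint φ₀ t r' θ))
      (pd 1 G (boxPoint φ₀ t r θ)) r := fun r hr ↦ hasDerivAt_comp_boxPoint_r (hd r hr)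
  have hl : Continuous fun r : ℝ ↦ boxPoint φ₀ t r θ :=
    (continuous_boxPoint φ₀).comp (Continuous.prodMk continuous_const
      (Continuous.prodMk continuous_id continuous_const))
  have hcont : ContinuousOn (fun r ↦ pd 1 G (boxPoint φ₀ t r θ)) (Icc M R) :=
    (contDiffOn_pd hW₀ hG 1).continuousOn.comp hl.continuousOn fun r hr ↦ hline r hr
  exact intervalIntegral_sq_le_four_mul hR hderiv hcont hGR

/-- The first Hardy inequality along an `r`-line for a globally smooth `G` (the form used for the
global class `Φ ∈ C^∞(E4)`). [cite: Aretakis2012, §4.4 (Prop. 4.4.1)] -/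
theorem line_sq_le_hardy_of_contDiff (hG : ContDiff ℝ ∞ G) {t R φ₀ θ : ℝ} (hR : M ≤ R)
    (hGR : G (boxPoint φ₀ t R θ) = 0) :
    ∫ r in M..R, G (boxPoint φ₀ t r θ) ^ 2 ≤
      4 * ∫ r in M..R, (r - M) ^ 2 * pd 1 G (boxPoint φ₀ t r θ) ^ 2 :=
  line_sq_le_hardy isOpen_univ hG.contDiffOn hR (fun _ _ ↦ Set.mem_univ _) hGR

/-- **The near-horizon `N`-energy bound in coordinates, zeroth-order terms absorbed.**
[cite: Aretakis2012, §13.1] -/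
theorem nEnergy_absorbed_box_estimate (hM : 0 < M) (hW₀ : IsOpen W₀) (hG : ContDiffOn ℝ ∞ G W₀)
    (hP : ∀ q ∈ W₀, sin (q 2) ≠ 0 → radOp M M G q + angOp M G q = 0)
    {t₁ t₂ R φ₀ : ℝ} (ht : t₁ ≤ t₂) (hR : 23 / 21 * M ≤ R)
    (hbox : ∀ t ∈ Icc t₁ t₂, ∀ r ∈ Icc M R, ∀ θ ∈ Icc 0 π, boxPoint φ₀ t r θ ∈ W₀)
    (hfar0 : ∀ θ ∈ Icc 0 π, G (boxPoint φ₀ t₂ R θ) = 0)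
    (hfar1 : ∀ t ∈ Icc t₁ t₂, ∀ θ ∈ Icc 0 π, ∀ i, pd i G (boxPoint φ₀ t R θ) = 0) :
    1 / 2 * (∫ θ in (0 : ℝ)..π, ∫ r in M..(23 / 21 * M), nEnergyLower M G (boxPoint φ₀ t₂ r θ)) +
        (∫ t in t₁..t₂, ∫ θ in (0 : ℝ)..π, ∫ r in M..(23 / 21 * M), nBulkLower M G (boxPoint φ₀ t r θ)) ≤
      (∫ θ in (0 : ℝ)..π, ∫ r in M..(23 / 21 * M),
          -multDensity M M (nProfileR M) (nProfileT M) nProfileW G (boxPoint φ₀ t₁ r θ)) +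
        (∫ t in t₁..t₂, ∫ θ in (0 : ℝ)..π,
          multFluxR M M (nProfileR M) (nProfileT M) nProfileW G (boxPoint φ₀ t (23 / 21 * M) θ)) +
        216 * M * ∫ θ in (0 : ℝ)..π, ∫ r in M..R, tEnergy M M G (boxPoint φ₀ t₁ r θ) := by
  have hπ : (0 : ℝ) ≤ π := pi_pos.le
  have hMN : M ≤ 23 / 21 * M := by linarith
  have hMR : M ≤ R := hMN.trans hR
  have hboxN : ∀ t ∈ Icc t₁ t₂, ∀ r ∈ Icc M (23 / 21 * M), ∀ θ ∈ Icc 0 π, boxPoint φ₀ t r θ ∈ W₀ :=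
    fun t ht' r hr θ hθ ↦ hbox t ht' r ⟨hr.1, hr.2.trans hR⟩ θ hθ
  have ht₂ : t₂ ∈ Icc t₁ t₂ := right_mem_Icc.mpr ht
  -- (0) the identity-based estimate
  have h0 := nEnergy_box_estimate hM hW₀ hG hP ht hboxN (φ₀ := φ₀)
  -- smoothness bookkeeping
  have h0' := contDiffOn_pd hW₀ hG 0
  have h1 := contDiffOn_pd hW₀ hG 1
  have h2 := contDiffOn_pd hW₀ hG 2
  have hc : ∀ j : Fin 4, ContDiffOn ℝ ∞ (fun q : E4 ↦ q j) W₀ := fun j ↦ (Kerr.contDiff_coord j).contDiffOn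
  have hsin : ContDiffOn ℝ ∞ (fun q : E4 ↦ sin (q 2)) W₀ := contDiff_sin.comp_contDiffOn (hc 2)
  have hcos : ContDiffOn ℝ ∞ (fun q : E4 ↦ cos (q 2)) W₀ := contDiff_cos.comp_contDiffOn (hc 2)
  have hSig : ContDiffOn ℝ ∞ (fun q : E4 ↦ q 1 ^ 2 + M ^ 2 * cos (q 2) ^ 2 + 2 * M * q 1) W₀ :=
    (((hc 1).pow 2).add (contDiffOn_const.mul (hcos.pow 2))).add (contDiffOn_const.mul (hc 1))
  have hhq : ContDiffOn ℝ ∞ (fun q : E4 ↦ 20 * q 1 - 37 / 2 * M) W₀ :=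
    (contDiffOn_const.mul (hc 1)).sub contDiffOn_const
  have sLow : ContDiffOn ℝ ∞ (nEnergyLower M G) W₀ := by
    unfold nEnergyLower
    exact hsin.mul ((((contDiffOn_const.mul (h1.pow 2)).add (((hhq.mul hSig).div_const 16).mul
      (h0'.pow 2))).add ((contDiffOn_const.mul hhq).mul (h2.pow 2))))
  have sZ : ContDiffOn ℝ ∞ (nEnergyZeroth M G) W₀ := by
    unfold nEnergyZeroth
    exact (contDiffOn_const.mul hsin).mul (((((contDiffOn_const.mul (hc 1)).mul hG).mul h1).add
      (contDiffOn_const.mul (hG.pow 2))).sub ((hSig.mul hG).mul h0'))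
  have sG2 : ContDiffOn ℝ ∞ (fun q ↦ sin (q 2) * G q ^ 2) W₀ := hsin.mul (hG.pow 2)
  have sH : ContDiffOn ℝ ∞ (fun q ↦ 4 * (sin (q 2) * ((q 1 - M) ^ 2 * pd 1 G q ^ 2))) W₀ :=
    contDiffOn_const.mul (hsin.mul ((((hc 1).sub contDiffOn_const).pow 2).mul (h1.pow 2)))
  obtain ⟨sT, -, -⟩ := contDiffOn_tEnergy_tFlux (M := M) (a := M) hW₀ hG
  -- (1) absorb the zeroth-order terms pointwise and integrate over `𝓐_N` at `t₂`
  have h1' : (∫ θ in (0 : ℝ)..π, ∫ r in M..(23 / 21 * M), -nEnergyZeroth M G (boxPoint φ₀ t₂ r θ)) ≤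
      ∫ θ in (0 : ℝ)..π, ∫ r in M..(23 / 21 * M), (1 / 2 * nEnergyLower M G (boxPoint φ₀ t₂ r θ) +
        27 * M * (sin ((boxPoint φ₀ t₂ r θ) 2) * G (boxPoint φ₀ t₂ r θ) ^ 2)) := by
    refine box2_integral_mono (F := fun q ↦ -nEnergyZeroth M G q)
      (G := fun q ↦ 1 / 2 * nEnergyLower M G q + 27 * M * (sin (q 2) * G q ^ 2))
      sZ.continuousOn.neg ((contDiffOn_const.mul sLow).add (contDiffOn_const.mul sG2)).continuousOn hMN
      (fun r hr θ hθ ↦ hboxN t₂ ht₂ r hr θ hθ) fun r hr θ hθ ↦ ?_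
    exact neg_nEnergyZeroth_le hM G (q := boxPoint φ₀ t₂ r θ) (by simpa using hr.1) (by simpa using hr.2)
      (by simpa using hθ)
  have h1s : (∫ θ in (0 : ℝ)..π, ∫ r in M..(23 / 21 * M), (1 / 2 * nEnergyLower M G (boxPoint φ₀ t₂ r θ) +
        27 * M * (sin ((boxPoint φ₀ t₂ r θ) 2) * G (boxPoint φ₀ t₂ r θ) ^ 2))) =
      1 / 2 * (∫ θ in (0 : ℝ)..π, ∫ r in M..(23 / 21 * M), nEnergyLower M G (boxPoint φ₀ t₂ r θ)) +
        27 * M * ∫ θ in (0 : ℝ)..π, ∫ r in M..(23 / 21 * M),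
          sin ((boxPoint φ₀ t₂ r θ) 2) * G (boxPoint φ₀ t₂ r θ) ^ 2 := by
    rw [box2_integral_add (F := fun q ↦ 1 / 2 * nEnergyLower M G q) (G := fun q ↦ 27 * M * (sin (q 2) * G q ^ 2))
      (contDiffOn_const.mul sLow).continuousOn (contDiffOn_const.mul sG2).continuousOn hMN
      (fun r hr θ hθ ↦ hboxN t₂ ht₂ r hr θ hθ)]
    simp only [intervalIntegral.integral_const_mul]
  -- (2) enlarge the domain of the `G²` integral to `[M, R]`
  have h2' : (∫ θ in (0 : ℝ)..π, ∫ r in M..(23 / 21 * M), sin ((boxPoint φ₀ t₂ r θ) 2) * G (boxPoint φ₀ t₂ r θ) ^ 2) ≤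
      ∫ θ in (0 : ℝ)..π, ∫ r in M..R, sin ((boxPoint φ₀ t₂ r θ) 2) * G (boxPoint φ₀ t₂ r θ) ^ 2 := by
    refine theta_integral_mono_of_line (F := fun q ↦ sin (q 2) * G q ^ 2) (G := fun q ↦ sin (q 2) * G q ^ 2)
      sG2.continuousOn sG2.continuousOn hMN hMR (fun r hr θ hθ ↦ hboxN t₂ ht₂ r hr θ hθ)
      (fun r hr θ hθ ↦ hbox t₂ ht₂ r hr θ hθ) fun θ hθ ↦ ?_
    have hl : Continuous fun r : ℝ ↦ boxPoint φ₀ t₂ r θ :=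
      (continuous_boxPoint φ₀).comp (Continuous.prodMk continuous_const
        (Continuous.prodMk continuous_id continuous_const))
    have hco : ContinuousOn (fun r ↦ sin ((boxPoint φ₀ t₂ r θ) 2) * G (boxPoint φ₀ t₂ r θ) ^ 2) (Icc M R) :=
      sG2.continuousOn.comp hl.continuousOn fun r hr ↦ hbox t₂ ht₂ r hr θ hθ
    refine intervalIntegral.integral_mono_interval le_rfl hMN hR ?_ (hco.intervalIntegrable_of_Icc hMR)
    refine MeasureTheory.ae_of_all _ fun r ↦ ?_
    simp only [boxPoint_apply_two]
    exact mul_nonneg (sin_nonneg_of_nonneg_of_le_pi hθ.1 hθ.2) (sq_nonneg _)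
  -- (3) Hardy along each line at `t₂`
  have h3' : (∫ θ in (0 : ℝ)..π, ∫ r in M..R, sin ((boxPoint φ₀ t₂ r θ) 2) * G (boxPoint φ₀ t₂ r θ) ^ 2) ≤
      ∫ θ in (0 : ℝ)..π, ∫ r in M..R, 4 * (sin ((boxPoint φ₀ t₂ r θ) 2) *
        (((boxPoint φ₀ t₂ r θ) 1 - M) ^ 2 * pd 1 G (boxPoint φ₀ t₂ r θ) ^ 2)) := by
    refine theta_integral_mono_of_line (F := fun q ↦ sin (q 2) * G q ^ 2)
      (G := fun q ↦ 4 * (sin (q 2) * ((q 1 - M) ^ 2 * pd 1 G q ^ 2)))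
      sG2.continuousOn sH.continuousOn hMR hMR (fun r hr θ hθ ↦ hbox t₂ ht₂ r hr θ hθ)
      (fun r hr θ hθ ↦ hbox t₂ ht₂ r hr θ hθ) fun θ hθ ↦ ?_
    simp only [boxPoint_apply_two, boxPoint_apply_one]
    rw [intervalIntegral.integral_const_mul, intervalIntegral.integral_const_mul,
      intervalIntegral.integral_const_mul]
    have hH := line_sq_le_hardy hW₀ hG hMR (fun r hr ↦ hbox t₂ ht₂ r hr θ hθ) (hfar0 θ hθ) (φ₀ := φ₀)
    have hs : 0 ≤ sin θ := sin_nonneg_of_nonneg_of_le_pi hθ.1 hθ.2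
    nlinarith [mul_le_mul_of_nonneg_left hH hs]
  -- (4) the weighted derivative is dominated by the `T`-energy density
  have h4' : (∫ θ in (0 : ℝ)..π, ∫ r in M..R, 4 * (sin ((boxPoint φ₀ t₂ r θ) 2) *
        (((boxPoint φ₀ t₂ r θ) 1 - M) ^ 2 * pd 1 G (boxPoint φ₀ t₂ r θ) ^ 2))) ≤
      ∫ θ in (0 : ℝ)..π, ∫ r in M..R, 8 * tEnergy M M G (boxPoint φ₀ t₂ r θ) := by
    refine box2_integral_mono (F := fun q ↦ 4 * (sin (q 2) * ((q 1 - M) ^ 2 * pd 1 G q ^ 2)))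
      (G := fun q ↦ 8 * tEnergy M M G q) sH.continuousOn (contDiffOn_const.mul sT).continuousOn hMR
      (fun r hr θ hθ ↦ hbox t₂ ht₂ r hr θ hθ) fun r hr θ hθ ↦ ?_
    have hs : 0 ≤ sin θ := sin_nonneg_of_nonneg_of_le_pi hθ.1 hθ.2
    have hrM : M ≤ r := hr.1
    simp only [tEnergy, boxPoint_apply_one, boxPoint_apply_two]
    nlinarith [mul_nonneg hs (mul_nonneg (by nlinarith [sq_nonneg (cos θ)] :
      (0 : ℝ) ≤ r ^ 2 + M ^ 2 * cos θ ^ 2 + 2 * M * r) (sq_nonneg (pd 0 G (boxPoint φ₀ t₂ r θ)))),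
      mul_nonneg hs (sq_nonneg (pd 2 G (boxPoint φ₀ t₂ r θ)))]
  have h4s : (∫ θ in (0 : ℝ)..π, ∫ r in M..R, 8 * tEnergy M M G (boxPoint φ₀ t₂ r θ)) =
      8 * ∫ θ in (0 : ℝ)..π, ∫ r in M..R, tEnergy M M G (boxPoint φ₀ t₂ r θ) := by
    simp only [intervalIntegral.integral_const_mul]
  -- (5) the `T`-energy is non-increasing (no flux through the outer cylinder)
  have hfarT : ∀ t ∈ Icc t₁ t₂, ∀ θ ∈ Icc (0 : ℝ) π, tFluxR M M G (boxPoint φ₀ t R θ) = 0 := by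
    intro t ht' θ hθ
    simp only [tFluxR, hfar1 t ht' θ hθ, mul_zero, add_zero, zero_pow two_ne_zero]
  have h5 := (tEnergy_extremal_antitone hW₀ hG hP ht hMR hbox hfarT).1
  -- (6) `T`-energy is non-negative (for the final multiplication by `M`)
  have hT0 : 0 ≤ ∫ θ in (0 : ℝ)..π, ∫ r in M..R, tEnergy M M G (boxPoint φ₀ t₁ r θ) := by
    refine intervalIntegral.integral_nonneg hπ fun θ hθ ↦ intervalIntegral.integral_nonneg hMR fun r hr ↦ ?_
    have hs : 0 ≤ sin θ := sin_nonneg_of_nonneg_of_le_pi hθ.1 hθ.2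
    have hrM : M ≤ r := hr.1
    simp only [tEnergy, boxPoint_apply_one, boxPoint_apply_two]
    have hΔ : (0 : ℝ) ≤ r ^ 2 - 2 * M * r + M ^ 2 := by nlinarith [sq_nonneg (r - M)]
    have hSg : (0 : ℝ) ≤ r ^ 2 + M ^ 2 * cos θ ^ 2 + 2 * M * r := by nlinarith [sq_nonneg (cos θ)]
    positivity
  -- assemble
  simp only [intervalIntegral.integral_neg] at h1'
  rw [h1s] at h1'
  have h27 : 27 * M * (∫ θ in (0 : ℝ)..π, ∫ r in M..(23 / 21 * M),
      sin ((boxPoint φ₀ t₂ r θ) 2) * G (boxPoint φ₀ t₂ r θ) ^ 2) ≤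
      27 * M * (8 * ∫ θ in (0 : ℝ)..π, ∫ r in M..R, tEnergy M M G (boxPoint φ₀ t₁ r θ)) := by
    refine mul_le_mul_of_nonneg_left ?_ (by positivity)
    rw [h4s] at h4'
    linarith
  linarith

end Coord

/-! ### The class -/

variable [Kerr.Facts] [Kerr.SliceFacts] {M r₀ : ℝ} {U₀ : Set (Kerr.region M r₀)} {Φ : E4 → ℝ}

/-- **The near-horizon `N`-energy bound for Aretakis's class (§13.1 on `𝓐_N`, zeroth-order terms
absorbed into the conserved degenerate `T`-energy).** For `Φ` smooth at the points of an open
`U₀ ⊇ {r ≥ M, t* ≥ 0}` of the extremal Kerr region (`a = M > 0`), invariant under the axial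
rotations (where `r_BL > 0`), solving `□_g ψ = 0` on `U₀`, with `ψ, dψ` vanishing for `|x| > ρ` on
`{t* = 0} ∩ U₀`, and `0 ≤ t₁ ≤ t₂ ≤ T`, `r₂ > max(ρ, 2M) + 1 + T`: with `G = Φ ∘ κ`,
`½ ∫∫_{𝓐_N} e_low(t₂) + ∫_{t₁}^{t₂}∫∫_{𝓐_N} K_low
   ≤ ∫∫_{𝓐_N} E_N(t₁) + ∫_{t₁}^{t₂}∫₀^π F_N(t, 23M/21, θ) dθ dt + 216 M ∫₀^π∫_M^{r₂} tEnergy(t₁)`.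
The only term not controlled here is the flux of `J^{N,−1/2}` through `{r = 23M/21}` (in the source:
the cut-off `N^δ` and Thm. 1). [cite: Aretakis2012, §13.1 and Prop. 13.2.1] -/
theorem nEnergy_bound_of_class (hM : 0 < M) (hr₀ : r₀ ∈ Set.Ioo 0 M) (hU₀ : IsOpen U₀)
    (hKU : {x : Kerr.region M r₀ | Kerr.rPlus M M ≤ Kerr.radius M (x : E4) ∧ 0 ≤ (x : E4) 0} ⊆ U₀)
    (hΦ : ∀ x ∈ U₀, ContDiffAt ℝ ∞ Φ x)
    (haxi : ∀ (β : ℝ) (z : E4), 0 < Kerr.radius M z → Φ (E4.axialRotation β z) = Φ z)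
    (hsol : ∀ x ∈ U₀, (Kerr.smoothMetric M M r₀).toPseudoRiemannianMetric.dalembertian
      (fun y : Kerr.region M r₀ ↦ Φ y) x = 0)
    {ρ : ℝ} (hloc : ∀ x ∈ U₀, (x : E4) 0 = 0 → ρ < E4.spatialNorm (x : E4) → Φ x = 0 ∧ fderiv ℝ Φ x = 0)
    {t₁ t₂ T r₂ φ₀ : ℝ} (ht₁ : 0 ≤ t₁) (ht : t₁ ≤ t₂) (hT : t₂ ≤ T) (hr₂ : max ρ (2 * M) + 1 + T < r₂) :
    1 / 2 * (∫ θ in (0 : ℝ)..π, ∫ r in M..(23 / 21 * M),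
        nEnergyLower M (Kerr.starPull M Φ) (boxPoint φ₀ t₂ r θ)) +
        (∫ t in t₁..t₂, ∫ θ in (0 : ℝ)..π, ∫ r in M..(23 / 21 * M),
          nBulkLower M (Kerr.starPull M Φ) (boxPoint φ₀ t r θ)) ≤
      (∫ θ in (0 : ℝ)..π, ∫ r in M..(23 / 21 * M),
          -multDensity M M (nProfileR M) (nProfileT M) nProfileW (Kerr.starPull M Φ) (boxPoint φ₀ t₁ r θ)) +
        (∫ t in t₁..t₂, ∫ θ in (0 : ℝ)..π,
          multFluxR M M (nProfileR M) (nProfileT M) nProfileW (Kerr.starPull M Φ)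
            (boxPoint φ₀ t (23 / 21 * M) θ)) +
        216 * M * ∫ θ in (0 : ℝ)..π, ∫ r in M..r₂, tEnergy M M (Kerr.starPull M Φ) (boxPoint φ₀ t₁ r θ) := by
  obtain ⟨hr₀pos, hr₀M⟩ := hr₀
  have hR : 23 / 21 * M ≤ r₂ := by
    have : 2 * M ≤ max ρ (2 * M) := le_max_right _ _
    linarith [ht₁, ht, hT]
  have hMr₂ : M ≤ r₂ := by linarith
  -- the coordinate open set and the separated equation off the axis
  set V : Set E4 := Subtype.val '' U₀ with hVdef
  have hV : IsOpen V := (Kerr.region M r₀).isOpen.isOpenMap_subtype_val U₀ hU₀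
  have hΦV : ∀ z ∈ V, ContDiffAt ℝ ∞ Φ z := by
    rintro _ ⟨y, hyU, rfl⟩; exact hΦ y hyU
  set W₀ : Set E4 := {q : E4 | 0 < q 1 ∧ Kerr.starChart M q ∈ V} with hW₀def
  have hW₀ : IsOpen W₀ := (isOpen_lt continuous_const (PiLp.continuous_apply 2 _ 1)).inter
    (hV.preimage (Kerr.contDiff_starChart M (n := 0)).continuous)
  have hG : ContDiffOn ℝ ∞ (Kerr.starPull M Φ) W₀ := fun q hq ↦
    (Kerr.contDiffAt_comp_starChart (hΦV _ hq.2)).contDiffWithinAt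
  obtain ⟨-, -, -, hsep, -⟩ := separated_equations_starPull hU₀ hΦ haxi hsol
  have hP : ∀ q ∈ W₀, Real.sin (q 2) ≠ 0 →
      radOp M M (Kerr.starPull M Φ) q + angOp M (Kerr.starPull M Φ) q = 0 :=
    fun q hq hs ↦ hsep q ⟨hq.1, hs, hq.2⟩
  -- the box lies in `W₀`
  have hK'reg : ∀ x : E4, Kerr.rPlus M M ≤ Kerr.radius M x ∧ 0 ≤ x 0 → x ∈ Kerr.region M r₀ := by
    intro x hx
    rw [Kerr.mem_region]
    have h1 := hx.1
    rw [Kerr.rPlus_self] at h1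
    exact max_lt (by linarith) (by linarith)
  have hbox : ∀ t ∈ Icc t₁ t₂, ∀ r ∈ Icc M r₂, ∀ θ ∈ Icc 0 π, boxPoint φ₀ t r θ ∈ W₀ := by
    intro t ht' r hr' θ _
    have hK := shellPoint_mem_horizonFutureSet hM (ht₁.trans ht'.1) hr'.1 θ φ₀
    refine ⟨hM.trans_le hr'.1, ?_⟩
    rw [starChart_boxPoint]
    exact ⟨⟨_, hK'reg _ hK⟩, hKU hK, rfl⟩
  -- far-field vanishing on the outer cylinder
  have hfar : ∀ t ∈ Icc t₁ t₂, ∀ θ : ℝ, Kerr.starPull M Φ (boxPoint φ₀ t r₂ θ) = 0 ∧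
      ∀ i, pd i (Kerr.starPull M Φ) (boxPoint φ₀ t r₂ θ) = 0 := by
    intro t ht' θ
    obtain ⟨hΦ0, hdΦ0⟩ := fderiv_shellPoint_eq_zero_of_far hM ⟨hr₀pos, hr₀M⟩ hU₀ hKU hΦ hsol hloc hr₂
      (ht₁.trans ht'.1) (ht'.2.trans hT) θ φ₀
    have hK := shellPoint_mem_horizonFutureSet hM (ht₁.trans ht'.1) hMr₂ θ φ₀
    have hq : boxPoint φ₀ t r₂ θ ∈ W₀ := by
      refine ⟨hM.trans_le hMr₂, ?_⟩
      rw [starChart_boxPoint]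
      exact ⟨⟨_, hK'reg _ hK⟩, hKU hK, rfl⟩
    have hd : DifferentiableAt ℝ Φ (shellPoint M t r₂ θ φ₀) := by
      rw [← starChart_boxPoint]; exact (hΦV _ hq.2).differentiableAt (by simp)
    refine ⟨?_, fun i ↦ ?_⟩
    · rw [Kerr.starPull_apply, starChart_boxPoint]; exact hΦ0
    · rw [pd_starPull_boxPoint hd, hdΦ0]; rfl
  exact nEnergy_absorbed_box_estimate hM hW₀ hG hP ht hR hbox
    (fun θ _ ↦ (hfar t₂ (right_mem_Icc.mpr ht) θ).1) (fun t ht' θ _ i ↦ (hfar t ht' θ).2 i)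

end Literature.Barriers.FinalStateConjecture.Kerr

end
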